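import Summits.HodgeConjecture.HodgeConjecture.Theorems.Ring2AbelianAllWeilBaseChangeQuartic
import Mathlib.Data.Rat.Lemmas
import HarnessLib

/-!
# Ring 2 · AbelianAll (ab-weil-1, gen 140, part BCA-a) — the quartics `P_{d,a} = T⁴ + (2d − 2a)T² + (d + a)²`
  of `E = ℚ(√-d, √a)` for every non-square `a`, and the parity weights `a^{k/2}`

research route conditional on HC_CM; not a corollary; Q11.4-sentence-2 already refuted in dim ≥ 3.
`HC_CM` (`Theses.RankFourFaces.CMAbelianHodge`) does not occur in this file and no open case of the Hodge
conjecture is claimed: this file is pure algebra (polynomials over `ℤ`/`ℚ`/`ℂ`). It is the arithmetic layer of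
LEMMA BC ALONG `K(√a)` (`Ring2AbelianAllWeilBaseChangeAlong.lean`): the base change of Weil type from
`K = ℚ(√-d)` to the quartic CM field `E = K(√a)` for an ARBITRARY non-square `a ≥ 2` (gen 139 did `a = 2` only:
`bcQuartic d = bcQuarticAlong d 2`, `bcQuarticAlong_two`). The point of the parameter `a`: one CM quartic field
can serve several imaginary quadratic fields — `ℚ(ζ₁₂) = ℚ(√-1, √3) = ℚ(√-3, √3)` carries Weil's question for
both `ℚ(i)` (`P_{1,3} = T⁴ − 4T² + 16`, root `2ζ₁₂ = √3 + i`) and `ℚ(√-3)` (`P_{3,3} = T⁴ + 36`), and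
`ℚ(ζ₈) = ℚ(√-1, √2) = ℚ(√-2, √2)` both `ℚ(i)` and `ℚ(√-2)`; and `a := δ` (the discriminant) is the base change
under which the `E`-Hermitian form becomes split (memo ROUTE-P2-g3 §4.3, LEMMA HYP — not formalised here).

## What is proved (0 sorry)

* `bcQuarticAlong d a = X⁴ + C(2d − 2a)·X² + C((d + a)²) ∈ ℤ[T]` — the minimal polynomial of `√a + i√d`:
  monic, degree 4 (`bcQuarticAlong_monic/_natDegree`), its evaluation in any ring (`eval₂_bcQuarticAlong`, used
  in the noncommutative ring `End (A × A)`), in `ℂ`, and its image in `ℚ[T]`;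
* **irreducible over `ℚ` for every non-square `a` and `d ≥ 1`** (`bcQuarticAlong_irreducible`): a rational root
  contradicts `P_{d,a}(x) = (x² + d − a)² + 4ad > 0`; a factorisation into rational monic quadratics
  `(x² + px + b)(x² − px + e)` forces `p = 0 ∧ (b − e)² = −16ad`, or `e = b = d + a ∧ p² = 4a` (so `a = (p/2)²`
  is a square — excluded), or `e = b = −(d + a) ∧ p² = −4d`;
* **CM**: the complex roots are non-real (`conj_ne_self_of_bcQuarticAlong`), have `|ρ|² = d + a`
  (`normSq_of_bcQuarticAlong`), and `Q_{d,a} = (−T³ + (2a − 2d)T)/(d + a) ∈ ℚ[T]` induces complex conjugation on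
  all of them (`exists_conjPolynomial_bcQuarticAlong`); the roots are `μ + σ` with `μ² = −d`, `σ² = a`
  (`bcQuarticAlong_root`);
* the parity weights `evenPowWeightAlong a k = a^{k/2}·[k even] ∈ ℚ` with `(√a)^k + (−√a)^k = 2·e_k`
  (`sqrt_pow_add_neg_sqrt_pow`), `e_0 = 1`.

What is NOT proved or claimed: anything about abelian varieties (part BCA-b); no Literature fact is introduced;
no internally-minted statement is cited as a fact.

## References

* [vanGeemen1994HodgeAV] B. van Geemen, An introduction to the Hodge conjecture for abelian varieties,
  LNM 1594 (1994), 4.9–4.12.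
* [MoonenZarhin1998WeilClasses] B. Moonen, Yu. Zarhin, Weil classes on abelian varieties,
  J. reine angew. Math. 496 (1998), §1.
-/

noncomputable section

set_option linter.dupNamespace false

open Polynomial
open scoped BigOperators

namespace Summit.HodgeConjecture.HodgeConjecture.Ring2.AbelianAll

/-! ### §1 The quartic `P_{d,a}` -/

section Quartic

/-- `P_{d,a} = T⁴ + (2d − 2a)·T² + (d + a)² ∈ ℤ[T]`, the minimal polynomial of `√a + i√d` — a generator of the
biquadratic CM field `E = ℚ(√-d, √a)` (`a` a non-square). -/
def bcQuarticAlong (d a : ℕ) : Polynomial ℤ :=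
  X ^ 4 + C (2 * (d : ℤ) - 2 * a) * X ^ 2 + C (((d : ℤ) + a) ^ 2)

variable (d a : ℕ)

/-- `P_{d,2} = P_d` (the gen-139 quartic of `E = ℚ(√-d, √2)`). -/
theorem bcQuarticAlong_two : bcQuarticAlong d 2 = bcQuartic d := by
  unfold bcQuarticAlong bcQuartic
  push_cast
  ring_nf

/-- `P_{d,a}` is monic. -/
theorem bcQuarticAlong_monic : (bcQuarticAlong d a).Monic := by
  unfold bcQuarticAlong; monicity!

/-- `P_{d,a}` has degree `4`. -/
theorem bcQuarticAlong_natDegree : (bcQuarticAlong d a).natDegree = 4 := by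
  unfold bcQuarticAlong; compute_degree!

/-- Evaluation of `P_{d,a}` in any ring (also noncommutative: used in `End (A × A)`). -/
theorem eval₂_bcQuarticAlong {R : Type*} [Ring R] (x : R) :
    Polynomial.eval₂ (Int.castRingHom R) x (bcQuarticAlong d a) =
      x ^ 4 + ((2 * (d : ℤ) - 2 * a : ℤ) : R) * x ^ 2 + ((((d : ℤ) + a) ^ 2 : ℤ) : R) := by
  unfold bcQuarticAlong
  simp only [Polynomial.eval₂_add, Polynomial.C_mul_X_pow_eq_monomial, Polynomial.eval₂_monomial,
    Polynomial.eval₂_X_pow, Polynomial.eval₂_C]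
  rfl

/-- `P_{d,a}` evaluated at a complex number. -/
theorem eval₂_bcQuarticAlong_complex (x : ℂ) :
    Polynomial.eval₂ (Int.castRingHom ℂ) x (bcQuarticAlong d a) =
      x ^ 4 + (2 * (d : ℂ) - 2 * a) * x ^ 2 + ((d : ℂ) + a) ^ 2 := by
  rw [eval₂_bcQuarticAlong]; push_cast; ring

/-- The image of `P_{d,a}` in `ℚ[T]`. -/
theorem bcQuarticAlong_map :
    (bcQuarticAlong d a).map (Int.castRingHom ℚ) =
      X ^ 4 + C (2 * (d : ℚ) - 2 * a) * X ^ 2 + C (((d : ℚ) + a) ^ 2) := by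
  unfold bcQuarticAlong
  simp only [Polynomial.map_add, Polynomial.map_mul, Polynomial.map_pow, Polynomial.map_X,
    Polynomial.map_C]
  have h1 : (Int.castRingHom ℚ) (2 * (d : ℤ) - 2 * a) = 2 * (d : ℚ) - 2 * a := by simp
  have h2 : (Int.castRingHom ℚ) (((d : ℤ) + a) ^ 2) = ((d : ℚ) + a) ^ 2 := by simp
  rw [h1, h2]

/-- A non-square is positive. -/
theorem pos_of_not_isSquare {a : ℕ} (ha : ¬ IsSquare a) : 0 < a := by
  refine Nat.pos_of_ne_zero ?_
  rintro rfl
  exact ha IsSquare.zero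

/-- No rational `p` with `p² = 4a` for a non-square natural number `a`. -/
theorem no_rat_sq_eq_four_mul {a : ℕ} (ha : ¬ IsSquare a) (p : ℚ) (h : p ^ 2 = 4 * a) : False := by
  have hsq : IsSquare (a : ℚ) := ⟨p / 2, by linear_combination -h / 4⟩
  exact ha (Rat.isSquare_natCast_iff.mp hsq)

/-- **`P_{d,a}` is irreducible over `ℚ` for `d ≥ 1` and `a` a non-square** (exclusion of rational linear and
quadratic factors of the monic quartic). -/
theorem bcQuarticAlong_irreducible_rat (hd : 0 < d) (ha : ¬ IsSquare a) :
    Irreducible (X ^ 4 + C (2 * (d : ℚ) - 2 * a) * X ^ 2 + C (((d : ℚ) + a) ^ 2) : Polynomial ℚ) := by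
  set α : ℚ := 2 * (d : ℚ) - 2 * a with hα
  set β : ℚ := ((d : ℚ) + a) ^ 2 with hβ
  have hd' : (1 : ℚ) ≤ d := by exact_mod_cast hd
  have ha' : (1 : ℚ) ≤ a := by exact_mod_cast pos_of_not_isSquare ha
  have had : (1 : ℚ) ≤ (a : ℚ) * d := by nlinarith
  have hm : (X ^ 4 + C α * X ^ 2 + C β : Polynomial ℚ).Monic := by monicity!
  have hdeg : (X ^ 4 + C α * X ^ 2 + C β : Polynomial ℚ).natDegree = 4 := by compute_degree!
  have hne1 : (X ^ 4 + C α * X ^ 2 + C β : Polynomial ℚ) ≠ 1 := by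
    intro h; have := congrArg Polynomial.natDegree h; rw [hdeg] at this; simp at this
  rw [hm.irreducible_iff_lt_natDegree_lt hne1]
  intro q hq hqdeg
  rw [hdeg, Finset.mem_Ioc] at hqdeg
  rintro ⟨r, hr⟩
  have hrm : r.Monic := Polynomial.Monic.of_mul_monic_left hq (hr ▸ hm)
  have hsum : q.natDegree + r.natDegree = 4 := by
    rw [← Polynomial.Monic.natDegree_mul hq hrm, ← hr, hdeg]
  have hev : ∀ x : ℚ, x ^ 4 + α * x ^ 2 + β = Polynomial.eval x q * Polynomial.eval x r := by
    intro x
    have := congrArg (Polynomial.eval x) hr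
    simpa [Polynomial.eval_mul] using this
  rcases Nat.lt_or_ge q.natDegree 2 with h1 | h2
  · -- degree 1: a rational root, but `P_{d,a}(x) = (x² + d − a)² + 4ad > 0`
    have hq1 : q.natDegree = 1 := by omega
    set a0 := q.coeff 0 with ha0
    have hqf : q = X + C a0 := hq.eq_X_add_C hq1
    have h0 := hev (-a0)
    rw [hqf, Polynomial.eval_add, Polynomial.eval_X, Polynomial.eval_C] at h0
    have h0' : a0 ^ 4 + α * a0 ^ 2 + β = 0 := by
      have : (-a0) ^ 4 + α * (-a0) ^ 2 + β = 0 := by rw [h0]; ring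
      linear_combination this
    rw [hα, hβ] at h0'
    nlinarith [sq_nonneg a0, sq_nonneg (a0 ^ 2 + d - a)]
  · -- degree 2: a rational quadratic factor
    have hq2 : q.natDegree = 2 := by omega
    have hr2 : r.natDegree = 2 := by omega
    set p := q.coeff 1 with hp
    set b := q.coeff 0 with hb
    set c := r.coeff 1 with hc
    set e := r.coeff 0 with he
    have hqf : q = X ^ 2 + C p * X + C b := by
      have := hq.as_sum; rw [hq2] at this; rw [this]
      simp only [Finset.sum_range_succ, Finset.sum_range_zero, zero_add, pow_zero, mul_one, pow_one]; ring
    have hrf : r = X ^ 2 + C c * X + C e := by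
      have := hrm.as_sum; rw [hr2] at this; rw [this]
      simp only [Finset.sum_range_succ, Finset.sum_range_zero, zero_add, pow_zero, mul_one, pow_one]; ring
    have hev' : ∀ x : ℚ, x ^ 4 + α * x ^ 2 + β = (x ^ 2 + p * x + b) * (x ^ 2 + c * x + e) := by
      intro x; have := hev x; rw [hqf, hrf] at this
      simpa [Polynomial.eval_add, Polynomial.eval_mul, Polynomial.eval_pow, Polynomial.eval_X,
        Polynomial.eval_C] using this
    have e0 := hev' 0
    have e1 := hev' 1
    have em1 := hev' (-1)
    have e2 := hev' 2
    have em2 := hev' (-2)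
    have hA3 : p + c = 0 := by linear_combination (-(e2 - em2) + 2 * (e1 - em1)) / 12
    have hA1 : p * e + b * c = 0 := by
      linear_combination (-(e1 - em1)) / 2 - (-(e2 - em2) + 2 * (e1 - em1)) / 12
    have hA0 : b * e = β := by linear_combination -e0
    have hA2 : b + e + p * c = α := by linear_combination (-(e1 + em1)) / 2 + e0
    have hc' : c = -p := by linear_combination hA3
    rw [hc'] at hA1 hA2
    have hpd : p * (e - b) = 0 := by linear_combination hA1
    rcases mul_eq_zero.1 hpd with h0 | heb
    · -- `p = 0`: `b + e = 2d − 2a`, `be = (d + a)²`, so `(b − e)² = −16ad < 0`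
      rw [h0] at hA2
      have hbe : b + e = α := by linear_combination hA2
      rw [hα] at hbe; rw [hβ] at hA0
      nlinarith [sq_nonneg (b - e)]
    · -- `e = b`: `b² = (d + a)²` and `p² = 2b − 2d + 2a ∈ {4a, −4d}`
      have heb' : e = b := by linarith
      rw [heb'] at hA0 hA2
      rw [hβ] at hA0; rw [hα] at hA2
      have hb2 : (b - (d + a)) * (b + (d + a)) = 0 := by linear_combination hA0
      rcases mul_eq_zero.1 hb2 with hb1 | hb1
      · have : p ^ 2 = 4 * a := by nlinarith
        exact no_rat_sq_eq_four_mul ha p this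
      · nlinarith [sq_nonneg p]

/-- **`P_{d,a} ⊗ ℚ` is irreducible** (`d ≥ 1`, `a` non-square): `ℚ[T]/(P_{d,a}) ≅ E = ℚ(√-d, √a)` is a field
of degree `4`. -/
theorem bcQuarticAlong_irreducible (hd : 0 < d) (ha : ¬ IsSquare a) :
    Irreducible ((bcQuarticAlong d a).map (Int.castRingHom ℚ)) := by
  rw [bcQuarticAlong_map]; exact bcQuarticAlong_irreducible_rat d a hd ha

/-- The complex roots of `P_{d,a}` are NON-REAL (`P_{d,a}(x) = (x² + d − a)² + 4ad > 0` on `ℝ`; `d, a ≥ 1`). -/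
theorem conj_ne_self_of_bcQuarticAlong (hd : 0 < d) (ha : 0 < a) {ρ : ℂ}
    (hρ : Polynomial.eval₂ (Int.castRingHom ℂ) ρ (bcQuarticAlong d a) = 0) :
    starRingEnd ℂ ρ ≠ ρ := by
  rw [eval₂_bcQuarticAlong_complex] at hρ
  intro hc
  have hre : ((ρ.re : ℝ) : ℂ) = ρ := Complex.conj_eq_iff_re.mp hc
  have hr : ((ρ.re ^ 4 + (2 * (d : ℝ) - 2 * a) * ρ.re ^ 2 + ((d : ℝ) + a) ^ 2 : ℝ) : ℂ) = 0 := by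
    push_cast; rw [hre]; exact hρ
  have hr' : ρ.re ^ 4 + (2 * (d : ℝ) - 2 * a) * ρ.re ^ 2 + ((d : ℝ) + a) ^ 2 = 0 := by exact_mod_cast hr
  have hd' : (1 : ℝ) ≤ d := by exact_mod_cast hd
  have ha' : (1 : ℝ) ≤ a := by exact_mod_cast ha
  nlinarith [sq_nonneg ρ.re, sq_nonneg (ρ.re ^ 2 + d - a), mul_pos (zero_lt_one.trans_le hd') (zero_lt_one.trans_le ha')]

/-- Every complex root `ρ` of `P_{d,a}` has `|ρ|² = d + a`. -/
theorem normSq_of_bcQuarticAlong {ρ : ℂ}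
    (hρ : Polynomial.eval₂ (Int.castRingHom ℂ) ρ (bcQuarticAlong d a) = 0) :
    Complex.normSq ρ = (d : ℝ) + a := by
  rw [eval₂_bcQuarticAlong_complex] at hρ
  -- `u = ρ² + (d − a)` has `u² = −4ad`, hence is purely imaginary with `|u|² = 4ad`
  set u : ℂ := ρ ^ 2 + ((d : ℂ) - a) with hu
  have hu2 : u ^ 2 = -4 * (a : ℂ) * d := by rw [hu]; linear_combination hρ
  have hre : u.re * u.re - u.im * u.im = -4 * (a : ℝ) * d := by
    have := congrArg Complex.re hu2
    simp [pow_two, Complex.mul_re] at this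
    linarith
  have him : 2 * (u.re * u.im) = 0 := by
    have := congrArg Complex.im hu2
    simp [pow_two, Complex.mul_im] at this
    linarith
  have hure : u.re = 0 := by
    by_contra h
    have : u.im = 0 := by
      have := mul_eq_zero.1 (by linarith : u.re * u.im = 0)
      exact this.resolve_left h
    rw [this] at hre
    have hd0 : (0 : ℝ) ≤ (a : ℝ) * d := by positivity
    have h1 : u.re * u.re = -4 * (a : ℝ) * d := by simpa using hre
    have h2 : 0 < u.re * u.re := mul_self_pos.2 h
    linarith
  -- `ρ² = u + (a − d)`, so `|ρ²|² = (a − d)² + |u|² = (d + a)²`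
  have hρ2 : ρ ^ 2 = u + ((a : ℂ) - d) := by rw [hu]; ring
  have hn2 : Complex.normSq (ρ ^ 2) = ((d : ℝ) + a) ^ 2 := by
    rw [hρ2, Complex.normSq_apply]
    have h1 : (u + ((a : ℂ) - d)).re = (a : ℝ) - d := by simp [hure]
    have h2 : (u + ((a : ℂ) - d)).im = u.im := by simp
    rw [h1, h2]
    nlinarith [hre, hure]
  have hn : Complex.normSq ρ ^ 2 = ((d : ℝ) + a) ^ 2 := by rw [← hn2, map_pow]
  have h0 : 0 ≤ Complex.normSq ρ := Complex.normSq_nonneg ρ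
  have hd0 : (0 : ℝ) ≤ (d : ℝ) + a := by positivity
  nlinarith [sq_nonneg (Complex.normSq ρ - ((d : ℝ) + a)), sq_nonneg (Complex.normSq ρ + ((d : ℝ) + a))]

/-- **The CM involution of `E` is a polynomial**: `Q_{d,a} = (−T³ + (2a − 2d)T)/(d + a) ∈ ℚ[T]` carries every
complex root `ρ` of `P_{d,a}` to `ρ̄ = (d + a)/ρ` (`d ≥ 1`). -/
theorem exists_conjPolynomial_bcQuarticAlong (hd : 0 < d) :
    ∃ Q : Polynomial ℚ, ∀ ρ : ℂ, Polynomial.eval₂ (Int.castRingHom ℂ) ρ (bcQuarticAlong d a) = 0 →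
      Polynomial.eval₂ (algebraMap ℚ ℂ) ρ Q = starRingEnd ℂ ρ := by
  refine ⟨C (1 / ((d : ℚ) + a)) * (-X ^ 3 + C (2 * (a : ℚ) - 2 * d) * X), fun ρ hρ => ?_⟩
  have hn := normSq_of_bcQuarticAlong d a hρ
  rw [eval₂_bcQuarticAlong_complex] at hρ
  have hda : (0 : ℝ) < (d : ℝ) + a := by
    have : (1 : ℝ) ≤ d := by exact_mod_cast hd
    positivity
  have hρ0 : ρ ≠ 0 := by
    intro h; rw [h, map_zero] at hn
    linarith
  have hconj : starRingEnd ℂ ρ = (((d : ℝ) + a : ℝ) : ℂ) / ρ := by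
    rw [eq_div_iff hρ0, ← hn, mul_comm, Complex.mul_conj]
  have hd2 : ((d : ℂ) + a) ≠ 0 := by
    have : ((d : ℂ) + a) = (((d : ℝ) + a : ℝ) : ℂ) := by push_cast; ring
    rw [this, Complex.ofReal_ne_zero]; exact hda.ne'
  rw [hconj]
  simp only [Polynomial.eval₂_mul, Polynomial.eval₂_C, Polynomial.eval₂_add, Polynomial.eval₂_neg,
    Polynomial.eval₂_pow, Polynomial.eval₂_X, eq_ratCast]
  push_cast
  rw [div_mul_eq_mul_div, one_mul, div_eq_div_iff hd2 hρ0]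
  linear_combination (-1 : ℂ) * hρ

/-- `P_{d,a}(μ + σ) = 0` whenever `μ² = −d` and `σ² = a`: the four complex roots `±i√d ± √a` of `P_{d,a}`. -/
theorem bcQuarticAlong_root {μ σ : ℂ} (hμ : μ ^ 2 = -(d : ℂ)) (hσ : σ ^ 2 = (a : ℂ)) :
    Polynomial.eval₂ (Int.castRingHom ℂ) (μ + σ) (bcQuarticAlong d a) = 0 := by
  rw [eval₂_bcQuarticAlong_complex]
  have h2 : (μ + σ) ^ 2 = (a : ℂ) - d + 2 * μ * σ := by linear_combination hμ + hσ
  have h4 : (μ + σ) ^ 4 = ((a : ℂ) - d + 2 * μ * σ) ^ 2 := by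
    rw [show (μ + σ) ^ 4 = ((μ + σ) ^ 2) ^ 2 by ring, h2]
  rw [h4, h2]
  linear_combination (4 * σ ^ 2) * hμ + (-4 * (d : ℂ)) * hσ

/-- `σ² = a` for `σ = √a`. -/
theorem sqrt_natCast_sq : ((Real.sqrt a : ℝ) : ℂ) ^ 2 = (a : ℂ) := by
  rw [← Complex.ofReal_pow, Real.sq_sqrt (Nat.cast_nonneg a)]; push_cast; rfl

end Quartic

/-! ### §2 The parity weights `a^{k/2}` -/

section Weights

/-- The parity weights `e_k = ((√a)^k + (−√a)^k)/2 ∈ ℚ`: `a^{k/2}` for even `k`, `0` for odd `k`. -/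
def evenPowWeightAlong (a k : ℕ) : ℚ := if Even k then (a : ℚ) ^ (k / 2) else 0

variable (a : ℕ)

/-- `(√a)^k + (−√a)^k = 2 e_k`. -/
theorem sqrt_pow_add_neg_sqrt_pow (k : ℕ) :
    ((Real.sqrt a : ℝ) : ℂ) ^ k + (-((Real.sqrt a : ℝ) : ℂ)) ^ k = 2 * (evenPowWeightAlong a k : ℂ) := by
  have h2 : ((Real.sqrt a : ℝ) : ℂ) ^ 2 = (a : ℂ) := sqrt_natCast_sq a
  rcases Nat.even_or_odd k with ⟨j, rfl⟩ | ⟨j, rfl⟩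
  · have hj : (j + j) / 2 = j := by omega
    have hp : ((Real.sqrt a : ℝ) : ℂ) ^ (j + j) = (a : ℂ) ^ j := by rw [← two_mul, pow_mul, h2]
    rw [evenPowWeightAlong, if_pos ⟨j, rfl⟩, hj, Even.neg_pow ⟨j, rfl⟩, hp]
    push_cast; ring
  · rw [evenPowWeightAlong, if_neg (Nat.not_even_iff_odd.mpr ⟨j, rfl⟩), Odd.neg_pow ⟨j, rfl⟩]
    push_cast; ring

/-- The zeroth parity weight is `1` (so the rational weights sum to `1`). -/
theorem evenPowWeightAlong_zero : evenPowWeightAlong a 0 = 1 := by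
  simp [evenPowWeightAlong]

/-- `e_k` for `a = 2` is the gen-139 weight `evenPowWeight k`. -/
theorem evenPowWeightAlong_two (k : ℕ) : evenPowWeightAlong 2 k = evenPowWeight k := by
  simp [evenPowWeightAlong, evenPowWeight]

end Weights

end Summit.HodgeConjecture.HodgeConjecture.Ring2.AbelianAll

end
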